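import Literature.NumberTheory.EllipticCurves.CMTorsionCartanMatrixOrdinaryProofs
import Literature.NumberTheory.EllipticCurves.CMTorsionGaloisImageProofs
import Literature.NumberTheory.EllipticCurves.SerreOpenImageSupersingularInertiaProofs
import Literature.NumberTheory.EllipticCurves.SerreOpenImageOrdinaryInertiaProofs
import Literature.NumberTheory.EllipticCurves.SerreOpenImageTameKummerProofs
import Literature.NumberTheory.EllipticCurves.CMTwistCocycleProofs
import Literature.NumberTheory.EllipticCurves.CMTorsionTwistCharacterProofs
import Literature.NumberTheory.EllipticCurves.GeomEndRingTransport
import Literature.NumberTheory.EllipticCurves.IsogenyHasCMIffJMemProofs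
import Literature.NumberTheory.EllipticCurves.GlobalMinimalModelProofs
import HarnessLib

/-!
# `cmTorsion_cartanImage` holds (Lang, *Elliptic Functions*, Ch. 10 §4): the discharge

Topic `NumberTheory/EllipticCurves`; theorems only (no definitions, no named facts).  This file
proves `theorem cmTorsion_cartanImage_holds : cmTorsion_cartanImage`, the named fact of
`CMTorsionGaloisImage.lean` (S. Lang, *Elliptic Functions*, 2nd ed., GTM 112, Ch. 10 §4, Remark
and Thm. 8, read on the `ℓ`-torsion of CM elliptic curves over `ℚ`).  It is organised in two
parts, each with its own section docstring below:

* **Part 1** (arithmetic core; Serre, *Invent. Math.* 15 (1972), §1.11/§4.5 in place of Lang's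
  idelic argument, for which the tree has no class field theory): for a reference curve `R/ℚ`
  in global minimal form with a twisted `√D` and a good prime `ℓ > 3`, `ℓ ∤ D`, every unit
  `a + bφ` of `𝔽_ℓ[φ]` is the exact action of some `σ ∈ ker χ` on `R[ℓ]`
  (`exists_smul_eq_add_mul_of_not_dvd_minimalDiscriminantInt`), using the matrix lemmas of
  `CMTorsionCartanMatrixProofs` (supersingular) and `CMTorsionCartanMatrixOrdinaryProofs`
  (ordinary).
* **Part 2** (twisting and uniformity): transport to every curve with the same `j` through the
  `ℚ̄`-isomorphism and its cocycle of exponent `12` (`CMTwistCocycleProofs`,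
  `CMTorsionTwistCharacterProofs`, `GeomEndRingTransport`), and the maximum of the thresholds
  over the thirteen CM `j`-invariants (`WeierstrassCurve.hasCM_iff_j_mem_holds`,
  `WeierstrassCurve.hasGlobalMinimalModel_rat_holds`): `cmTorsion_cartanImage_holds`.

## References

* [Lang1987] S. Lang, *Elliptic Functions*, 2nd ed., GTM 112 (1987), Ch. 10 §4, Remark, Thm. 8.
* [Serre1972] J.-P. Serre, *Propriétés galoisiennes des points d'ordre fini des courbes
  elliptiques*, Invent. Math. 15 (1972) 259–331, §1.11 (Prop. 11–12, Cor.), §4.5.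
* [SilvermanAEC2009] J. H. Silverman, *The Arithmetic of Elliptic Curves*, 2nd ed. (2009),
  III.9.4, VIII.8.3, X.5.4, C.11.
-/

/-!
## Part 1. The Cartan image on `E[ℓ]` at a good prime `ℓ` of a CM curve over `ℚ` in global
## minimal form

Topic `NumberTheory/EllipticCurves`; theorems only (no definitions, no named facts).  This is
the arithmetic core of the discharge of the named fact
`Literature.NumberTheory.EllipticCurves.cmTorsion_cartanImage` (S. Lang, *Elliptic Functions*,
2nd ed., GTM 112, Ch. 10 §4, Remark and Thm. 8 — the main theorem of complex multiplication —
read on the `ℓ`-torsion of a CM elliptic curve over `ℚ`): its Cartan-image clause (6), **with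
exponent `1`**, for a curve having **good reduction at `ℓ`**.

`exists_smul_eq_add_mul_of_not_dvd_minimalDiscriminantInt`: let `E = W/ℚ` be elliptic and
globally minimal, `ℓ > 3` a prime with `ℓ ∤ Δ_E`, and let `φ ∈ End(E[ℓ])`, `D ∈ ℤ`,
`χ : Γ_ℚ → {±1}` satisfy `φ² = D`, `ℓ ∤ D`, `χ ≠ 1` and the twist `φ(σP) = χ(σ)·σφ(P)` (as
supplied for a CM curve by Lang's Remark, the tree's
`WeierstrassCurve.exists_sqrt_twist_geomTorsion_of_hasCM`).  Then **for all `a, b ∈ ℤ` with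
`ℓ ∤ a² - Db²` some `σ ∈ ker χ` acts on `E[ℓ]` exactly as `a + bφ`**: the image of `Γ_K`,
`K = ℚ̄^{ker χ}`, contains the full Cartan subgroup `(𝔽_ℓ[φ])ˣ = (O/ℓ)ˣ`.

Lang proves this (over the CM field, for any idele) from Shimura's reciprocity law; neither ideles
nor the reciprocity map exist in the tree or in Mathlib.  The proof given here is the local one
of J.-P. Serre, Invent. Math. 15 (1972), §4.5 (CM case) via §1.11, entirely from theorems of the
tree.  Frame `E[ℓ] ≅ 𝔽_ℓ²` (`exists_frame_galoisRepTorsion_rat`); the matrix `Φ` of `φ` is a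
non-scalar square root of `D` and every `ρ̄(σ)` commutes or anti-commutes with it according to
`χ(σ)` (`exists_matrix_sqrt_frame`).  Let `𝔓` be the prime of `\bar ℤ` of the place over `ℓ`
(`exists_ideal_placeOver`) and `I = I_𝔓`.
* If `ℓ ∣ a_ℓ` (supersingular), `ρ̄(I)` is cyclic of order `ℓ² - 1` (Serre §1.11 Prop. 12 c):
  `isCyclic_and_card_inertia_map_of_dvd_frobeniusTrace`, with the tame Kummer character
  `exists_mem_inertia_smul_eq_mul_of_pow_eq`), hence equals the Cartan subgroup `𝔽_ℓ[Φ]ˣ`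
  (`forall_commute_and_exists_coe_eq_of_isCyclic`).
* If `ℓ ∤ a_ℓ` (ordinary), `I` fixes a line `𝔽_ℓ v₀` with trivial action on the quotient and
  every character value on the line (Serre §1.11 Prop. 11 and Cor.:
  `exists_line_of_not_dvd_frobeniusTrace`, `exists_mem_inertia_smul_eq_of_sub_mem_line`); with
  complex conjugation `σ₀` (`χ(σ₀) = -1`) the products `σ₀ τ^m σ₀⁻¹ τ^k`, `τ ∈ I`, realise the
  whole split Cartan subgroup (`exists_commute_and_forall_exists_coe_conj_pow_eq`).
In both cases the realising elements commute with `Φ`, so lie in `ker χ`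
(`false_of_commute_of_anticommute`).

## References

* [Lang1987] S. Lang, *Elliptic Functions*, 2nd ed., GTM 112 (1987), Ch. 10 §4, Remark, Thm. 8.
* [Serre1972] J.-P. Serre, *Propriétés galoisiennes des points d'ordre fini des courbes
  elliptiques*, Invent. Math. 15 (1972) 259–331, §1.11 (Prop. 11–12), §4.5.
-/

noncomputable section

open scoped Classical NumberField Pointwise MatrixGroups
open IsDedekindDomain Field Matrix

namespace Literature.NumberTheory.EllipticCurves

open _root_.WeierstrassCurve Rat.HeightOneSpectrum Literature.NumberTheory.GaloisRepresentations
open Literature.NumberTheory.GaloisRepresentations.DeligneSerre1974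

section Frame

variable (W : WeierstrassCurve ℚ) (ℓ : ℕ) [Fact ℓ.Prime]
  (e : W.geomTorsion ℓ ≃+ (Fin 2 → ZMod ℓ))
  (Φfr : Multiplicative (AddAut (W.geomTorsion ℓ)) ≃* GL (Fin 2) (ZMod ℓ))

/-- **The matrix of `√D` in a frame of `E[ℓ]`.**  For an additive frame `e : E[ℓ] ≃+ 𝔽_ℓ²` with
compatible `Φfr : Aut(E[ℓ]) ≅ GL₂(𝔽_ℓ)` and an endomorphism `φ` of `E[ℓ]` with `φ² = D`, no
integer scalar, twisted by `χ` under `Γ_ℚ` (`φ(σP) = χ(σ)·σφ(P)`): the matrix `Φ` of `φ`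
satisfies `Φ e(x) = e(φ x)`, `Φ² = D`, `Φ` is no scalar, and for every `σ` either
`Φ ρ̄(σ) = ρ̄(σ) Φ` and `χ(σ) = 1`, or `Φ ρ̄(σ) = -ρ̄(σ) Φ` and `χ(σ) = -1` — the Galois image lies
in the normaliser of the Cartan subgroup `𝔽_ℓ[Φ]ˣ` (Lang, Ch. 10 §4, Remark; Serre 1972, §4.5).
[cite: Serre1972, §4.5] -/
theorem exists_matrix_sqrt_frame
    (he : ∀ (g : Multiplicative (AddAut (W.geomTorsion ℓ))) (x : W.geomTorsion ℓ),
      e (Multiplicative.toAdd g x) =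
        ((Φfr g : GL (Fin 2) (ZMod ℓ)) : Matrix (Fin 2) (Fin 2) (ZMod ℓ)) *ᵥ e x)
    {φ : AddMonoid.End (W.geomTorsion ℓ)} {D : ℤ} {χ : absoluteGaloisGroup ℚ →* ℤˣ}
    (hφ : ∀ P : W.geomTorsion ℓ, φ (φ P) = D • P)
    (hns : ∀ c : ℤ, ∃ P : W.geomTorsion ℓ, φ P ≠ c • P)
    (htw : ∀ (σ : absoluteGaloisGroup ℚ) (P : W.geomTorsion ℓ),
      φ (σ • P) = ((χ σ : ℤˣ) : ℤ) • σ • φ P) :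
    ∃ Φ : Matrix (Fin 2) (Fin 2) (ZMod ℓ),
      (∀ x : W.geomTorsion ℓ, Φ *ᵥ e x = e (φ x)) ∧
      Φ * Φ = ((D : ℤ) : ZMod ℓ) • (1 : Matrix (Fin 2) (Fin 2) (ZMod ℓ)) ∧
      (∀ c : ZMod ℓ, Φ ≠ c • 1) ∧
      ∀ σ : absoluteGaloisGroup ℚ,
        (Φ * ((Φfr (galoisRepTorsion W ℓ σ) : GL (Fin 2) (ZMod ℓ)) : Matrix (Fin 2) (Fin 2) (ZMod ℓ)) =
            ((Φfr (galoisRepTorsion W ℓ σ) : GL (Fin 2) (ZMod ℓ)) : Matrix (Fin 2) (Fin 2) (ZMod ℓ)) * Φ ∧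
          χ σ = 1) ∨
        (Φ * ((Φfr (galoisRepTorsion W ℓ σ) : GL (Fin 2) (ZMod ℓ)) : Matrix (Fin 2) (Fin 2) (ZMod ℓ)) =
            -(((Φfr (galoisRepTorsion W ℓ σ) : GL (Fin 2) (ZMod ℓ)) : Matrix (Fin 2) (Fin 2) (ZMod ℓ)) * Φ) ∧
          χ σ = -1) := by
  have hp : ℓ.Prime := Fact.out
  haveI : NeZero ℓ := ⟨hp.ne_zero⟩
  -- the matrix of `φ`
  let f : (Fin 2 → ZMod ℓ) →ₗ[ZMod ℓ] (Fin 2 → ZMod ℓ) :=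
    (e.toAddMonoidHom.comp ((φ : W.geomTorsion ℓ →+ W.geomTorsion ℓ).comp
      e.symm.toAddMonoidHom)).toZModLinearMap ℓ
  set Φ : Matrix (Fin 2) (Fin 2) (ZMod ℓ) := LinearMap.toMatrix' f with hΦdef
  have hΦ : ∀ x : W.geomTorsion ℓ, Φ *ᵥ e x = e (φ x) := fun x ↦ by
    rw [hΦdef, LinearMap.toMatrix'_mulVec]
    change e (φ (e.symm (e x))) = e (φ x)
    rw [e.symm_apply_apply]
  have he' : ∀ (σ : absoluteGaloisGroup ℚ) (x : W.geomTorsion ℓ), e (σ • x) =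
      ((Φfr (galoisRepTorsion W ℓ σ) : GL (Fin 2) (ZMod ℓ)) : Matrix (Fin 2) (Fin 2) (ZMod ℓ)) *ᵥ e x :=
    fun σ x ↦ he (galoisRepTorsion W ℓ σ) x
  refine ⟨Φ, hΦ, ?_, ?_, ?_⟩
  · -- `Φ² = D`
    apply Matrix.toLin'.injective
    apply LinearMap.ext
    intro w
    obtain ⟨x, rfl⟩ := e.surjective w
    rw [Matrix.toLin'_apply, Matrix.toLin'_apply, ← Matrix.mulVec_mulVec, hΦ, hΦ, hφ, map_zsmul,
      Matrix.smul_mulVec, Matrix.one_mulVec, Int.cast_smul_eq_zsmul]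
  · -- non-scalar
    intro c hc
    obtain ⟨P, hP⟩ := hns (c.val : ℤ)
    apply hP
    apply e.injective
    rw [← hΦ, hc, Matrix.smul_mulVec, Matrix.one_mulVec, map_zsmul,
      ← Int.cast_smul_eq_zsmul (ZMod ℓ) (c.val : ℤ) (e P), Int.cast_natCast, ZMod.natCast_zmod_val]
  · -- normaliser
    intro σ
    rcases Int.units_eq_one_or (χ σ) with h1 | h1
    · refine Or.inl ⟨?_, h1⟩
      apply Matrix.toLin'.injective
      apply LinearMap.ext
      intro w
      obtain ⟨x, rfl⟩ := e.surjective w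
      rw [Matrix.toLin'_apply, Matrix.toLin'_apply, ← Matrix.mulVec_mulVec, ← Matrix.mulVec_mulVec,
        hΦ x, ← he' σ x, ← he' σ (φ x), hΦ (σ • x), htw, h1, Units.val_one, one_zsmul]
    · refine Or.inr ⟨?_, h1⟩
      apply Matrix.toLin'.injective
      apply LinearMap.ext
      intro w
      obtain ⟨x, rfl⟩ := e.surjective w
      rw [Matrix.toLin'_apply, Matrix.toLin'_apply, Matrix.neg_mulVec, ← Matrix.mulVec_mulVec,
        ← Matrix.mulVec_mulVec, hΦ x, ← he' σ x, ← he' σ (φ x), hΦ (σ • x), htw, h1, Units.val_neg,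
        Units.val_one, neg_one_zsmul, map_neg]

/-- **`χ(σ) = 1` as soon as `ρ̄(σ)` commutes with `√D`** (in the situation of
`exists_matrix_sqrt_frame`, `ℓ` odd): a non-scalar `Φ` cannot both commute and anti-commute with
an invertible matrix. [folklore] -/
theorem units_eq_one_of_commute (hℓ2 : ℓ ≠ 2) {χ : absoluteGaloisGroup ℚ →* ℤˣ}
    {Φ : Matrix (Fin 2) (Fin 2) (ZMod ℓ)} (hns : ∀ c : ZMod ℓ, Φ ≠ c • 1)
    (hiv : ∀ σ : absoluteGaloisGroup ℚ,
        (Φ * ((Φfr (galoisRepTorsion W ℓ σ) : GL (Fin 2) (ZMod ℓ)) : Matrix (Fin 2) (Fin 2) (ZMod ℓ)) =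
            ((Φfr (galoisRepTorsion W ℓ σ) : GL (Fin 2) (ZMod ℓ)) : Matrix (Fin 2) (Fin 2) (ZMod ℓ)) * Φ ∧
          χ σ = 1) ∨
        (Φ * ((Φfr (galoisRepTorsion W ℓ σ) : GL (Fin 2) (ZMod ℓ)) : Matrix (Fin 2) (Fin 2) (ZMod ℓ)) =
            -(((Φfr (galoisRepTorsion W ℓ σ) : GL (Fin 2) (ZMod ℓ)) : Matrix (Fin 2) (Fin 2) (ZMod ℓ)) * Φ) ∧
          χ σ = -1))
    (σ : absoluteGaloisGroup ℚ)
    (hc : Φ * ((Φfr (galoisRepTorsion W ℓ σ) : GL (Fin 2) (ZMod ℓ)) : Matrix (Fin 2) (Fin 2) (ZMod ℓ)) =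
      ((Φfr (galoisRepTorsion W ℓ σ) : GL (Fin 2) (ZMod ℓ)) : Matrix (Fin 2) (Fin 2) (ZMod ℓ)) * Φ) :
    χ σ = 1 := by
  rcases hiv σ with ⟨-, h⟩ | ⟨ha, -⟩
  · exact h
  · exact (false_of_commute_of_anticommute (two_ne_zero_of_ne_two hℓ2) hns hc ha).elim

/-- **Reading the action off the matrix**: if `ρ̄(σ)` has matrix `a + bΦ` in the frame (`Φ` the
matrix of `φ`), then `σ • P = (a + bφ) P` on `E[ℓ]`. [folklore] -/
theorem smul_eq_add_mul_apply_of_coe_eq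
    (he : ∀ (g : Multiplicative (AddAut (W.geomTorsion ℓ))) (x : W.geomTorsion ℓ),
      e (Multiplicative.toAdd g x) =
        ((Φfr g : GL (Fin 2) (ZMod ℓ)) : Matrix (Fin 2) (Fin 2) (ZMod ℓ)) *ᵥ e x)
    {φ : AddMonoid.End (W.geomTorsion ℓ)} {Φ : Matrix (Fin 2) (Fin 2) (ZMod ℓ)}
    (hΦ : ∀ x : W.geomTorsion ℓ, Φ *ᵥ e x = e (φ x)) {a b : ℤ} {σ : absoluteGaloisGroup ℚ}
    (hσ : ((Φfr (galoisRepTorsion W ℓ σ) : GL (Fin 2) (ZMod ℓ)) : Matrix (Fin 2) (Fin 2) (ZMod ℓ)) =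
      ((a : ℤ) : ZMod ℓ) • (1 : Matrix (Fin 2) (Fin 2) (ZMod ℓ)) + ((b : ℤ) : ZMod ℓ) • Φ)
    (P : W.geomTorsion ℓ) :
    σ • P = ((a : AddMonoid.End (W.geomTorsion ℓ)) + (b : AddMonoid.End (W.geomTorsion ℓ)) * φ) P := by
  apply e.injective
  have h1 : e (σ • P) = ((Φfr (galoisRepTorsion W ℓ σ) : GL (Fin 2) (ZMod ℓ)) :
      Matrix (Fin 2) (Fin 2) (ZMod ℓ)) *ᵥ e P := he (galoisRepTorsion W ℓ σ) P
  rw [h1, hσ, Matrix.add_mulVec, Matrix.smul_mulVec, Matrix.smul_mulVec, Matrix.one_mulVec, hΦ]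
  change _ = e (((a : AddMonoid.End (W.geomTorsion ℓ)) P) + ((b : AddMonoid.End (W.geomTorsion ℓ)) (φ P)))
  rw [AddMonoid.End.intCast_apply, AddMonoid.End.intCast_apply, map_add, map_zsmul, map_zsmul,
    Int.cast_smul_eq_zsmul, Int.cast_smul_eq_zsmul]

end Frame

/-! ### The Cartan image at a good prime -/

section Reference

/-- **Lang, Ch. 10 §4, Thm. 8 on `E[ℓ]` at a good prime, exponent `1`** (proved along Serre 1972,
§4.5 and §1.11).  Let `E = W/ℚ` be an elliptic curve in global minimal form, `ℓ > 3` a prime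
with `ℓ ∤ Δ_E` (good reduction), and `φ ∈ End(E[ℓ])`, `D ∈ ℤ`, `χ : Γ_ℚ →* ℤˣ` with `φ ∘ φ = D`,
`ℓ ∤ D`, `χ ≠ 1` and `φ(σ • P) = χ(σ) • σ • φ(P)` for all `σ ∈ Γ_ℚ`.  Then for all integers
`a, b` with `ℓ ∤ a² - D b²` there is `σ ∈ Γ_ℚ` with `χ(σ) = 1` acting on `E[ℓ]` as `a + bφ`:
the image of `Γ_K = ker χ` in `Aut E[ℓ]` contains the whole Cartan subgroup `(𝔽_ℓ[φ])ˣ`.  At a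
supersingular `ℓ` the inertia group at the place over `ℓ` already has cyclic image of order
`ℓ² - 1` (Serre §1.11 Prop. 12 c)), which must be the Cartan subgroup; at an ordinary `ℓ` the
inertia group supplies the half-Cartan `diag(1, *)` in an eigenbasis of `φ` (§1.11 Prop. 11,
Cor.) and its conjugate by complex conjugation supplies `diag(*, 1)`.
[cite: Lang1987, Ch. 10 §4, Thm. 8] [cite: Serre1972, §4.5 and §1.11] -/
theorem exists_smul_eq_add_mul_of_not_dvd_minimalDiscriminantInt (W : WeierstrassCurve ℚ)
    [W.IsElliptic] [W.IsGloballyMinimal] (ℓ : ℕ) [Fact ℓ.Prime] (hℓ3 : 3 < ℓ)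
    (hΔ : ¬ (ℓ : ℤ) ∣ minimalDiscriminantInt W)
    {φ : AddMonoid.End (W.geomTorsion ℓ)} {D : ℤ} {χ : absoluteGaloisGroup ℚ →* ℤˣ}
    (hφ : ∀ P : W.geomTorsion ℓ, φ (φ P) = D • P) (hℓD : ¬ (ℓ : ℤ) ∣ D)
    (hχ : ∃ σ : absoluteGaloisGroup ℚ, χ σ ≠ 1)
    (htw : ∀ (σ : absoluteGaloisGroup ℚ) (P : W.geomTorsion ℓ),
      φ (σ • P) = ((χ σ : ℤˣ) : ℤ) • σ • φ P)
    (a b : ℤ) (hab : ¬ (ℓ : ℤ) ∣ a ^ 2 - D * b ^ 2) :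
    ∃ σ : absoluteGaloisGroup ℚ, χ σ = 1 ∧ ∀ P : W.geomTorsion ℓ,
      σ • P = ((a : AddMonoid.End (W.geomTorsion ℓ)) + (b : AddMonoid.End (W.geomTorsion ℓ)) * φ) P := by
  have hp : ℓ.Prime := Fact.out
  have hℓ2 : ℓ ≠ 2 := by omega
  letI : Module (ZMod ℓ) (W.geomTorsion ℓ) := AddSubgroup.torsionBy.zmodModule
  -- complex conjugation `σ₀` and the non-scalarity of `φ`
  obtain ⟨σ₀, hσ₀⟩ := hχ
  have hσ₀' : χ σ₀ = -1 := (Int.units_eq_one_or _).resolve_left hσ₀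
  have hanti : ∀ P : W.geomTorsion ℓ, φ (σ₀ • P) = -(σ₀ • φ P) := fun P ↦ by
    rw [htw, hσ₀', Units.val_neg, Units.val_one, neg_one_zsmul]
  have hnsZ : ∀ c : ℤ, ∃ P : W.geomTorsion ℓ, φ P ≠ c • P := fun c ↦
    W.geomTorsion_ne_smul_of_twist hp hℓ2 hℓD φ hφ hanti c
  -- frame and matrix of `φ`
  obtain ⟨e, Φfr, he, -, -, -, -⟩ := exists_frame_galoisRepTorsion_rat W ℓ
  obtain ⟨Φ, hΦ, hsq, hns, hiv⟩ := exists_matrix_sqrt_frame W ℓ e Φfr he hφ hnsZ htw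
  have he' : ∀ (σ : absoluteGaloisGroup ℚ) (x : W.geomTorsion ℓ), e (σ • x) =
      ((Φfr (galoisRepTorsion W ℓ σ) : GL (Fin 2) (ZMod ℓ)) : Matrix (Fin 2) (Fin 2) (ZMod ℓ)) *ᵥ e x :=
    fun σ x ↦ he (galoisRepTorsion W ℓ σ) x
  have hD0 : ((D : ℤ) : ZMod ℓ) ≠ 0 := by rwa [Ne, ZMod.intCast_zmod_eq_zero_iff_dvd]
  have habZ : ((a : ℤ) : ZMod ℓ) ^ 2 - ((D : ℤ) : ZMod ℓ) * ((b : ℤ) : ZMod ℓ) ^ 2 ≠ 0 := by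
    have h : ((a ^ 2 - D * b ^ 2 : ℤ) : ZMod ℓ) ≠ 0 := by rwa [Ne, ZMod.intCast_zmod_eq_zero_iff_dvd]
    push_cast at h
    exact h
  -- the place over `ℓ`, its prime `𝔓` and the representation into `GL₂(𝔽_ℓ)`
  obtain ⟨v, hv⟩ : ∃ v : HeightOneSpectrum (𝓞 ℚ), (primesEquiv v : ℕ) = ℓ :=
    ⟨primesEquiv.symm ⟨ℓ, hp⟩, by rw [Equiv.apply_symm_apply]⟩
  obtain ⟨𝔓, hmem, h𝔓⟩ := exists_ideal_placeOver ℓ hv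
  set ρ' : absoluteGaloisGroup ℚ →* GL (Fin 2) (ZMod ℓ) :=
    Φfr.toMonoidHom.comp (galoisRepTorsion W ℓ) with hρ'
  have hρ'apply : ∀ σ, ρ' σ = Φfr (galoisRepTorsion W ℓ σ) := fun σ ↦ rfl
  by_cases hss : (ℓ : ℤ) ∣ W.frobeniusTrace ℓ
  · -- supersingular reduction: the inertia image is cyclic of order `ℓ² - 1`
    have hm : 0 < ℓ ^ 2 - 1 := by
      have : 4 ≤ ℓ ^ 2 := by nlinarith [hp.two_le]
      omega
    obtain ⟨hcyc, hcard⟩ := isCyclic_and_card_inertia_map_of_dvd_frobeniusTrace ℓ hΔ hss hℓ2 hmem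
      (fun π ζ hπ hζ ↦ exists_mem_inertia_smul_eq_mul_of_pow_eq ℓ hm hv h𝔓 hπ hζ)
    set Hg : Subgroup (Multiplicative (AddAut (W.geomTorsion ℓ))) :=
      (𝔓.inertia (absoluteGaloisGroup ℚ)).map (galoisRepTorsion W ℓ) with hHg
    set H : Subgroup (GL (Fin 2) (ZMod ℓ)) := Hg.map Φfr.toMonoidHom with hH
    have eH : Hg ≃* H := Hg.equivMapOfInjective _ Φfr.injective
    haveI : IsCyclic H := by
      haveI := hcyc
      exact isCyclic_of_surjective eH eH.surjective
    have hcardH : Nat.card H = ℓ ^ 2 - 1 := by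
      rw [← hcard]
      exact (Nat.card_congr eH.toEquiv).symm
    have hmemH : ∀ g ∈ H, ∃ τ ∈ 𝔓.inertia (absoluteGaloisGroup ℚ), g = ρ' τ := by
      intro g hg
      obtain ⟨g', hg', rfl⟩ := Subgroup.mem_map.mp hg
      obtain ⟨τ, hτ, rfl⟩ := Subgroup.mem_map.mp hg'
      exact ⟨τ, hτ, rfl⟩
    have hN : ∀ g ∈ H, Φ * (g : Matrix (Fin 2) (Fin 2) (ZMod ℓ)) = (g : Matrix (Fin 2) (Fin 2) (ZMod ℓ)) * Φ ∨
        Φ * (g : Matrix (Fin 2) (Fin 2) (ZMod ℓ)) = -((g : Matrix (Fin 2) (Fin 2) (ZMod ℓ)) * Φ) := by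
      intro g hg
      obtain ⟨τ, -, rfl⟩ := hmemH g hg
      rcases hiv τ with ⟨h, -⟩ | ⟨h, -⟩
      · exact Or.inl h
      · exact Or.inr h
    obtain ⟨hcomm, hex⟩ := forall_commute_and_exists_coe_eq_of_isCyclic hℓ2 hsq hD0 hns H hcardH hN
    obtain ⟨g, hg, hgab⟩ := hex _ _ habZ
    have hcg := hcomm g hg
    obtain ⟨τ, -, rfl⟩ := hmemH g hg
    exact ⟨τ, units_eq_one_of_commute W ℓ Φfr hℓ2 hns hiv τ hcg,
      fun P ↦ smul_eq_add_mul_apply_of_coe_eq W ℓ e Φfr he hΦ hgab P⟩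
  · -- ordinary reduction: the inertia group fixes a line, with every character value on it
    obtain ⟨v₀, hv₀, hline⟩ := exists_line_of_not_dvd_frobeniusTrace ℓ hΔ hss hmem
    have honto := fun a ↦ W.exists_mem_inertia_smul_eq_of_sub_mem_line ℓ hv h𝔓 hv₀ hline a
    set S : Set (GL (Fin 2) (ZMod ℓ)) := {g | ∃ τ ∈ 𝔓.inertia (absoluteGaloisGroup ℚ), g = ρ' τ} with hS
    have hev₀ : e v₀ ≠ 0 := fun h0 ↦ hv₀ (e.injective (h0.trans (map_zero e).symm))
    have hSN : ∀ g ∈ S, Φ * (g : Matrix (Fin 2) (Fin 2) (ZMod ℓ)) = (g : Matrix (Fin 2) (Fin 2) (ZMod ℓ)) * Φ ∨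
        Φ * (g : Matrix (Fin 2) (Fin 2) (ZMod ℓ)) = -((g : Matrix (Fin 2) (Fin 2) (ZMod ℓ)) * Φ) := by
      rintro g ⟨τ, -, rfl⟩
      rcases hiv τ with ⟨h, -⟩ | ⟨h, -⟩
      · exact Or.inl h
      · exact Or.inr h
    have hquot : ∀ g ∈ S, ∀ w : Fin 2 → ZMod ℓ, ∃ b : ZMod ℓ,
        (g : Matrix (Fin 2) (Fin 2) (ZMod ℓ)) *ᵥ w - w = b • e v₀ := by
      rintro g ⟨τ, hτ, rfl⟩ w
      obtain ⟨x, rfl⟩ := e.surjective w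
      obtain ⟨b, hb⟩ := hline τ hτ x
      refine ⟨b, ?_⟩
      rw [hρ'apply, ← he' τ x, ← ZMod.map_smul e b v₀, ← hb, map_sub]
    have honto' : ∀ a : (ZMod ℓ)ˣ, ∃ g ∈ S,
        (g : Matrix (Fin 2) (Fin 2) (ZMod ℓ)) *ᵥ e v₀ = (a : ZMod ℓ) • e v₀ := by
      intro a
      obtain ⟨τ, hτ, hτa⟩ := honto a
      exact ⟨ρ' τ, ⟨τ, hτ, rfl⟩, by rw [hρ'apply, ← he' τ v₀, hτa, ZMod.map_smul]⟩
    have hn₀ : Φ * ((ρ' σ₀ : GL (Fin 2) (ZMod ℓ)) : Matrix (Fin 2) (Fin 2) (ZMod ℓ)) =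
        -(((ρ' σ₀ : GL (Fin 2) (ZMod ℓ)) : Matrix (Fin 2) (Fin 2) (ZMod ℓ)) * Φ) := by
      rcases hiv σ₀ with ⟨-, h⟩ | ⟨h, -⟩
      · exact absurd h hσ₀
      · exact h
    obtain ⟨s, ⟨τ, hτ, rfl⟩, hcommτ, hex⟩ :=
      exists_commute_and_forall_exists_coe_conj_pow_eq hℓ3 hsq hD0 hns hev₀ S hSN hquot honto' hn₀
    obtain ⟨m, k, hmk⟩ := hex _ _ habZ
    have hχτ : χ τ = 1 := units_eq_one_of_commute W ℓ Φfr hℓ2 hns hiv τ hcommτ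
    refine ⟨σ₀ * τ ^ m * σ₀⁻¹ * τ ^ k, ?_, fun P ↦ smul_eq_add_mul_apply_of_coe_eq W ℓ e Φfr he hΦ ?_ P⟩
    · simp only [map_mul, map_pow, map_inv, hχτ, one_pow, mul_one, mul_inv_cancel]
    · rw [← hρ'apply, map_mul, map_mul, map_mul, map_pow, map_inv, map_pow, ← hmk]

end Reference

end Literature.NumberTheory.EllipticCurves

end

/-!
## Part 2. Transport to all twists and the discharge `cmTorsion_cartanImage_holds`

Topic `NumberTheory/EllipticCurves`; theorems only (no definitions, no named facts).  This file
proves the named fact `Literature.NumberTheory.EllipticCurves.cmTorsion_cartanImage`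
(`CMTorsionGaloisImage.lean`; S. Lang, *Elliptic Functions*, 2nd ed., Ch. 10 §4, Remark and
Thm. 8, read on the `ℓ`-torsion): uniformly for CM elliptic curves `W/ℚ` and primes `ℓ > L₀`,
an endomorphism `φ = √D` of `W[ℓ]` with `φ² = D`, `ℓ ∤ D`, `φ` no scalar, a non-trivial quadratic
character `χ` with `φ(σP) = χ(σ)·σφ(P)`, and the Cartan-image clause: every unit `a + bφ` of
`𝔽_ℓ[φ]` is, up to the exponent `12`, the action of some `σ ∈ ker χ`.

Architecture of the proof (the tree has no idèles / class field theory, so Lang's analytic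
proof of Thm. 8 via the main theorem of complex multiplication is replaced by Serre's local
analysis at `ℓ`, *Invent. Math.* 15 (1972), §1.11 and §4.5, which the tree proves):

1. `CMTorsionCartanReferenceProofs`: for a **reference curve** `R/ℚ` in global minimal form with
   `√D ∈ End_{ℚ̄}(R)` twisted by `χ`, and a prime `ℓ > 3`, `ℓ ∤ D·Δ_min(R)` (good reduction), the
   tame inertia at `ℓ` (Serre §1.11: a cyclic group of order `ℓ² − 1` in the supersingular case,
   a Borel-shaped group with surjective character in the ordinary case), which lies in `ker χ`
   up to the computation of `CMTorsionCartanMatrix{,Ordinary}Proofs`, realises EVERY unit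
   `a + bφ` exactly: `σ • P = (a + bφ)P` on `R[ℓ]` for some `σ ∈ ker χ`.
2. `CMTwistCocycleProofs`: any `W/ℚ` with `j(W) = j(R)` is a twist of `R`: a bi-algebraic
   `ι : W(ℚ̄) ≃+ R(ℚ̄)` with `ι(σP) = c_σ(σ ι P)`, `c_σ ∈ Aut(R_{ℚ̄})`, `c_σ¹² = 1`
   (Silverman, *AEC*, X.5.4, III.10.2).
3. `CMTorsionTwistCharacterProofs` + `GeomEndRingTransport`: `√D` transports to
   `ψ_W = ι⁻¹√Dι ∈ End_{ℚ̄}(W)` with its own non-trivial twisting character `χ_W` (Lang's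
   Remark), and `σ ∈ ker χ_R` commutes with all of `End_{ℚ̄}(R) ∋ c_σ` (rank two), whence
   `ι(σ¹²P) = c_σ¹²(σ¹² ι P) = σ¹² ι P`: **`σ¹² ∈ ker χ_W` acts on `W[ℓ]` as `(a + bφ_W)¹²`**
   (`exists_sqrt_twist_cartan_of_j_eq`, this file).
4. Uniformity: CM curves over `ℚ` have one of thirteen `j`-invariants
   (`WeierstrassCurve.hasCM_iff_j_mem_holds`, *AEC* C.11); for each, a reference curve is a
   global minimal model (`WeierstrassCurve.hasGlobalMinimalModel_rat_holds`, *AEC* VIII.8.3) of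
   Mathlib's `WeierstrassCurve.ofJ j`, with threshold `max(3, |D|, |Δ_min|)`; `L₀` is the maximum
   over the thirteen (`cmTorsion_cartanImage_holds`), and conjunct (3) is supplied by
   `cmTorsion_cartanImage_of_sqrt_twist_cartan`.

## References

* S. Lang, *Elliptic Functions*, 2nd ed., GTM 112 (1987), Ch. 10 §4, Remark and Thm. 8.
  [Lang1987]
* J.-P. Serre, Propriétés galoisiennes des points d'ordre fini des courbes elliptiques,
  *Invent. Math.* 15 (1972), §1.11, §4.5. [Serre1972]
* J. H. Silverman, *The Arithmetic of Elliptic Curves*, 2nd ed. (2009), III.9.4, VIII.8.3,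
  X.5.4, C.11. [SilvermanAEC2009]
-/

noncomputable section

open scoped Classical

namespace Literature.NumberTheory.EllipticCurves

-- `_root_`: some import closures declare `Literature.NumberTheory.EllipticCurves.WeierstrassCurve.*`
open _root_.WeierstrassCurve
open Field (absoluteGaloisGroup)

/-! ## Transport from a reference curve to all curves with the same `j` -/

/-- **Conjuncts (1), (2), (4), (5), (6) of `cmTorsion_cartanImage` for every curve with the
`j`-invariant of a good reference curve.**  Let `R/ℚ` be an elliptic curve in global minimal
form, `ψ ∈ End_{ℚ̄}(R)` with `ψ² = D < 0` twisted by the non-trivial character `χ`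
(`ψ(σP) = χ(σ)·σψ(P)`), and `ℓ > 3` a prime with `ℓ ∤ D` and `ℓ ∤ Δ_min(R)`.  Then for every
elliptic curve `W/ℚ` with `j(W) = j(R)` there are `φ ∈ End W[ℓ]`, the same `D`, and a
non-trivial `χ' : Γ_ℚ →* ℤˣ` with `φ² = D`, `φ(σP) = χ'(σ)·σφ(P)`, and: for all `a, b` with
`ℓ ∤ a² − Db²` some `σ ∈ ker χ'` acts on `W[ℓ]` as `(a + bφ)¹²`.  Proof: `φ` is the restriction of
`ι⁻¹ψι` for the twist isomorphism `ι : W(ℚ̄) ≃+ R(ℚ̄)` of `CMTwistCocycleProofs`; the reference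
Cartan theorem `exists_smul_eq_add_mul_of_not_dvd_minimalDiscriminantInt` gives `σ ∈ ker χ`
acting on `R[ℓ]` as `a + bψ`; `σ` commutes with the cocycle value `c_σ ∈ End_{ℚ̄}(R)`
(`apply_smul_eq_smul_apply_of_mem_geomEndRing`), so `ι(σ¹²P) = c_σ¹²(σ¹²ιP) = σ¹²ιP =
(a + bψ)¹² ιP = ι((a + bι⁻¹ψι)¹²P)`.  (Lang, Ch. 10 §4, Thm. 8 with the Remark; Serre 1972,
§4.5.) [cite: Lang1987, Ch. 10 §4, Thm. 8 and Remark] -/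
theorem exists_sqrt_twist_cartan_of_j_eq (R : WeierstrassCurve ℚ) [R.IsElliptic]
    [R.IsGloballyMinimal] {ψ : AddMonoid.End R.geomPoints} (hψR : ψ ∈ R.geomEndRing) {D : ℤ}
    (hD : D < 0) (hψψ : ψ * ψ = (D : AddMonoid.End R.geomPoints))
    {χ : absoluteGaloisGroup ℚ →* ℤˣ} (hχ : ∃ σ : absoluteGaloisGroup ℚ, χ σ ≠ 1)
    (hrel : ∀ (σ : absoluteGaloisGroup ℚ) (P : R.geomPoints),
      ψ (σ • P) = ((χ σ : ℤˣ) : ℤ) • σ • ψ P)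
    (ℓ : ℕ) [Fact ℓ.Prime] (hℓ3 : 3 < ℓ) (hℓD : ¬ (ℓ : ℤ) ∣ D)
    (hΔ : ¬ (ℓ : ℤ) ∣ minimalDiscriminantInt R)
    (W : WeierstrassCurve ℚ) [W.IsElliptic] (hj : W.j = R.j) :
    ∃ (φ : AddMonoid.End (W.geomTorsion ℓ)) (D' : ℤ) (χ' : absoluteGaloisGroup ℚ →* ℤˣ),
      (∀ P : W.geomTorsion ℓ, φ (φ P) = D' • P) ∧ ¬ (ℓ : ℤ) ∣ D' ∧
      (∃ σ : absoluteGaloisGroup ℚ, χ' σ ≠ 1) ∧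
      (∀ (σ : absoluteGaloisGroup ℚ) (P : W.geomTorsion ℓ),
        φ (σ • P) = ((χ' σ : ℤˣ) : ℤ) • σ • φ P) ∧
      (∀ a b : ℤ, ¬ (ℓ : ℤ) ∣ a ^ 2 - D' * b ^ 2 →
        ∃ σ : absoluteGaloisGroup ℚ, χ' σ = 1 ∧ ∀ P : W.geomTorsion ℓ,
          σ • P = (((a : AddMonoid.End (W.geomTorsion ℓ)) +
            (b : AddMonoid.End (W.geomTorsion ℓ)) * φ) ^ 12) P) := by
  -- Step 0: the reference `√D` on `R[ℓ]`
  obtain ⟨φR, hφRcoe, hφRφR, hφRrel⟩ := exists_restrict_geomTorsion_of_twist R hψψ hrel ℓ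
  have hψψP : ∀ Q : R.geomPoints, ψ (ψ Q) = D • Q := fun Q ↦ by
    have := congrArg (fun f : AddMonoid.End R.geomPoints ↦ f Q) hψψ
    simpa only [AddMonoid.End.coe_mul, Function.comp_apply, AddMonoid.End.intCast_apply] using this
  -- Step 1: the twist isomorphism `ι : W(ℚ̄) ≃+ R(ℚ̄)` and its cocycle of exponent `12`
  obtain ⟨ι, hι, hι', hcoc⟩ := exists_addEquiv_geomPoints_cocycle_of_j_eq W R hj
  -- Step 2: transport `ψ` to `ψW = ι⁻¹ ψ ι ∈ End_{ℚ̄}(W)`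
  obtain ⟨e, he⟩ := exists_ringEquiv_geomEndRing_of_addEquiv ι hι hι'
  obtain ⟨ψW, hψWdef⟩ : ∃ ψW : AddMonoid.End W.geomPoints,
      ψW = ((e ⟨ψ, hψR⟩ : W.geomEndRing) : AddMonoid.End W.geomPoints) := ⟨_, rfl⟩
  have hψWmem : ψW ∈ W.geomEndRing := hψWdef ▸ (e ⟨ψ, hψR⟩).2
  have hψWapply : ∀ P : W.geomPoints, ψW P = ι.symm (ψ (ι P)) := fun P ↦ by
    rw [hψWdef]; exact he ⟨ψ, hψR⟩ P
  have hιψW : ∀ P : W.geomPoints, ι (ψW P) = ψ (ι P) := fun P ↦ by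
    rw [hψWapply, ι.apply_symm_apply]
  have hψWψW : ψW * ψW = (D : AddMonoid.End W.geomPoints) := by
    refine AddMonoidHom.ext fun P ↦ ?_
    change ψW (ψW P) = (D : AddMonoid.End W.geomPoints) P
    apply ι.injective
    rw [hιψW, hιψW, hψψP, AddMonoid.End.intCast_apply, map_zsmul]
  -- Step 3: the twisting character of `ψW` (Lang's Remark) and the restriction to `W[ℓ]`
  obtain ⟨χW, hχW, hrelW⟩ := exists_quadraticTwist_of_sq_eq_intCast W hψWmem hD hψWψW
  obtain ⟨φ, hφcoe, hφφ, hφrel⟩ := exists_restrict_geomTorsion_of_twist W hψWψW hrelW ℓ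
  refine ⟨φ, D, χW, hφφ, hℓD, hχW, hφrel, fun a b hab ↦ ?_⟩
  -- Step 4: the Cartan clause, transported from `R` with exponent `12`
  obtain ⟨σ, hσχ, hσact⟩ := exists_smul_eq_add_mul_of_not_dvd_minimalDiscriminantInt R ℓ hℓ3
    hΔ hφRφR hℓD hχ hφRrel a b hab
  refine ⟨σ ^ 12, ?_, fun P ↦ ?_⟩
  · rw [map_pow, show (12 : ℕ) = 2 * 6 from rfl, pow_mul, Int.units_sq, one_pow]
  -- `σ ∈ ker χ` fixes `ψ`, hence commutes with the cocycle value `c_σ ∈ End_{ℚ̄}(R)`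
  have hσψ : ∀ Q : R.geomPoints, ψ (σ • Q) = σ • ψ Q := fun Q ↦ by
    rw [hrel, hσχ, Units.val_one, one_zsmul]
  obtain ⟨c, hcalg, hc12, hcP⟩ := hcoc σ
  have hcmem : c ∈ R.geomEndRing := Subring.subset_closure hcalg
  have hιpow : ∀ (k : ℕ) (Q : W.geomPoints), ι (σ ^ k • Q) = (c ^ k) (σ ^ k • ι Q) := by
    intro k
    induction k with
    | zero => intro Q; simp only [pow_zero, one_smul, AddMonoid.End.coe_one, id_eq]
    | succ k ih =>
      intro Q
      rw [pow_succ', mul_smul, hcP, ih, mul_smul,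
        ← apply_smul_eq_smul_apply_of_mem_geomEndRing R hψR hD hψψ hσψ
          (R.geomEndRing.pow_mem hcmem k),
        pow_succ', AddMonoid.End.coe_mul, Function.comp_apply]
  have hισ12 : ι (σ ^ 12 • (P : W.geomPoints)) = σ ^ 12 • ι P := by
    rw [hιpow, hc12, AddMonoid.End.coe_one, id_eq]
  -- `ι P ∈ R[ℓ]`, on which `σ` acts as `a + b φR`, so `σ¹²` acts as `(a + bψ)¹²`
  have hιPmem : ι (P : W.geomPoints) ∈ R.geomTorsion ℓ := by
    have hP := P.2
    rw [Submodule.mem_toAddSubgroup, Submodule.mem_torsionBy_iff] at hP ⊢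
    rw [← map_zsmul, hP, map_zero]
  have hTRcoe : ∀ Q' : R.geomTorsion ℓ,
      ((((a : AddMonoid.End (R.geomTorsion ℓ)) + (b : AddMonoid.End (R.geomTorsion ℓ)) * φR) Q' :
        R.geomTorsion ℓ) : R.geomPoints) =
        ((a : AddMonoid.End R.geomPoints) + (b : AddMonoid.End R.geomPoints) * ψ) Q' := by
    intro Q'
    -- `(f + g) x = f x + g x` in `AddMonoid.End` holds by `rfl`
    change ((((a : AddMonoid.End (R.geomTorsion ℓ)) Q' +
        ((b : AddMonoid.End (R.geomTorsion ℓ)) * φR) Q' : R.geomTorsion ℓ)) : R.geomPoints) =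
      (a : AddMonoid.End R.geomPoints) (Q' : R.geomPoints) +
        ((b : AddMonoid.End R.geomPoints) * ψ) (Q' : R.geomPoints)
    rw [AddSubgroup.coe_add]
    simp only [AddMonoid.End.coe_mul, Function.comp_apply, AddMonoid.End.intCast_apply,
      AddSubgroupClass.coe_zsmul, hφRcoe]
  have hσ12R : σ ^ 12 • ι (P : W.geomPoints) =
      (((a : AddMonoid.End R.geomPoints) + (b : AddMonoid.End R.geomPoints) * ψ) ^ 12)
        (ι P) := by
    have h1 := congrArg (fun T : R.geomTorsion ℓ ↦ (T : R.geomPoints))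
      (pow_smul_eq_pow_apply R hσact 12 ⟨ι P, hιPmem⟩)
    simp only [AddSubgroup.torsionBy.coe_smul] at h1
    rw [coe_pow_apply_geomTorsion R hTRcoe 12] at h1
    exact h1
  -- the same bookkeeping on `W`, and `ι ∘ (a + bψW)¹² = (a + bψ)¹² ∘ ι` since `e` is a ring map
  have hTWcoe : ∀ P' : W.geomTorsion ℓ,
      ((((a : AddMonoid.End (W.geomTorsion ℓ)) + (b : AddMonoid.End (W.geomTorsion ℓ)) * φ) P' :
        W.geomTorsion ℓ) : W.geomPoints) =
        ((a : AddMonoid.End W.geomPoints) + (b : AddMonoid.End W.geomPoints) * ψW) P' := by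
    intro P'
    change ((((a : AddMonoid.End (W.geomTorsion ℓ)) P' +
        ((b : AddMonoid.End (W.geomTorsion ℓ)) * φ) P' : W.geomTorsion ℓ)) : W.geomPoints) =
      (a : AddMonoid.End W.geomPoints) (P' : W.geomPoints) +
        ((b : AddMonoid.End W.geomPoints) * ψW) (P' : W.geomPoints)
    rw [AddSubgroup.coe_add]
    simp only [AddMonoid.End.coe_mul, Function.comp_apply, AddMonoid.End.intCast_apply,
      AddSubgroupClass.coe_zsmul, hφcoe]
  have hez : ((e (((a : R.geomEndRing) + (b : R.geomEndRing) * ⟨ψ, hψR⟩) ^ 12) :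
      W.geomEndRing) : AddMonoid.End W.geomPoints) =
      ((a : AddMonoid.End W.geomPoints) + (b : AddMonoid.End W.geomPoints) * ψW) ^ 12 := by
    rw [map_pow, map_add, map_mul, map_intCast, map_intCast]
    push_cast
    rw [← hψWdef]
  have hz : ((((a : R.geomEndRing) + (b : R.geomEndRing) * ⟨ψ, hψR⟩) ^ 12 : R.geomEndRing) :
      AddMonoid.End R.geomPoints) =
      ((a : AddMonoid.End R.geomPoints) + (b : AddMonoid.End R.geomPoints) * ψ) ^ 12 := by
    push_cast
    rfl
  have hιTW : ι ((((a : AddMonoid.End W.geomPoints) + (b : AddMonoid.End W.geomPoints) * ψW) ^ 12)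
      (P : W.geomPoints)) =
      (((a : AddMonoid.End R.geomPoints) + (b : AddMonoid.End R.geomPoints) * ψ) ^ 12) (ι P) := by
    have h1 := he (((a : R.geomEndRing) + (b : R.geomEndRing) * ⟨ψ, hψR⟩) ^ 12) P
    rw [hez, hz] at h1
    rw [h1, ι.apply_symm_apply]
  apply Subtype.ext
  rw [AddSubgroup.torsionBy.coe_smul, coe_pow_apply_geomTorsion W hTWcoe 12 P]
  apply ι.injective
  rw [hισ12, hσ12R, hιTW]

/-! ## The discharge -/

/-- **`cmTorsion_cartanImage` holds** (Lang, *Elliptic Functions*, Ch. 10 §4, Remark and Thm. 8,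
read on the `ℓ`-torsion of CM elliptic curves over `ℚ`; proved here through Serre's local
analysis at good primes `ℓ`, *Invent. Math.* 15 (1972), §1.11/§4.5, and twisting).  The uniform
threshold is the maximum, over the thirteen CM `j`-invariants
(`WeierstrassCurve.hasCM_iff_j_mem_holds`), of `max(3, |D_j|, |Δ_min(R_j)|)` for a global minimal
model `R_j` (`WeierstrassCurve.hasGlobalMinimalModel_rat_holds`) of `WeierstrassCurve.ofJ j` and
its `√D_j` (`WeierstrassCurve.exists_sq_eq_intCast_quadraticTwist_of_hasCM`); the per-curve
statement is `exists_sqrt_twist_cartan_of_j_eq`, and the non-scalarity conjunct (3) is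
`cmTorsion_cartanImage_of_sqrt_twist_cartan`. [cite: Lang1987, Ch. 10 §4, Thm. 8 and Remark] -/
theorem cmTorsion_cartanImage_holds : cmTorsion_cartanImage := by
  apply cmTorsion_cartanImage_of_sqrt_twist_cartan
  -- a threshold for each of the thirteen CM `j`-invariants
  have key : ∀ j₀ ∈ cmJInvariants, ∃ L : ℕ, ∀ (W : WeierstrassCurve ℚ) [W.IsElliptic],
      W.j = j₀ → ∀ ℓ : ℕ, ℓ.Prime → L < ℓ →
      ∃ (φ : AddMonoid.End (W.geomTorsion ℓ)) (D : ℤ) (χ : absoluteGaloisGroup ℚ →* ℤˣ),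
        (∀ P : W.geomTorsion ℓ, φ (φ P) = D • P) ∧ ¬ (ℓ : ℤ) ∣ D ∧
        (∃ σ : absoluteGaloisGroup ℚ, χ σ ≠ 1) ∧
        (∀ (σ : absoluteGaloisGroup ℚ) (P : W.geomTorsion ℓ),
          φ (σ • P) = ((χ σ : ℤˣ) : ℤ) • σ • φ P) ∧
        (∀ a b : ℤ, ¬ (ℓ : ℤ) ∣ a ^ 2 - D * b ^ 2 →
          ∃ σ : absoluteGaloisGroup ℚ, χ σ = 1 ∧ ∀ P : W.geomTorsion ℓ,
            σ • P = (((a : AddMonoid.End (W.geomTorsion ℓ)) +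
              (b : AddMonoid.End (W.geomTorsion ℓ)) * φ) ^ 12) P) := by
    intro j₀ hj₀
    obtain ⟨C, hC⟩ := hasGlobalMinimalModel_rat_holds (WeierstrassCurve.ofJ j₀)
    have hRj : (C • WeierstrassCurve.ofJ j₀).j = j₀ := by rw [variableChange_j, ofJ_j]
    have hRCM : (C • WeierstrassCurve.ofJ j₀).HasCM :=
      (hasCM_iff_j_mem_holds (C • WeierstrassCurve.ofJ j₀)).mpr (by rw [hRj]; exact hj₀)
    obtain ⟨ψ, hψR, D, χ, hD, hψψ, hχ, hrel⟩ :=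
      (C • WeierstrassCurve.ofJ j₀).exists_sq_eq_intCast_quadraticTwist_of_hasCM hRCM
    refine ⟨max 3 (max D.natAbs (minimalDiscriminantInt (C • WeierstrassCurve.ofJ j₀)).natAbs),
      fun W _ hWj ℓ hℓ hLℓ ↦ ?_⟩
    haveI := Fact.mk hℓ
    have hℓ3 : 3 < ℓ := lt_of_le_of_lt (le_max_left _ _) hLℓ
    have hℓD' : D.natAbs < ℓ := lt_of_le_of_lt ((le_max_left _ _).trans (le_max_right _ _)) hLℓ
    have hℓΔ' : (minimalDiscriminantInt (C • WeierstrassCurve.ofJ j₀)).natAbs < ℓ :=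
      lt_of_le_of_lt ((le_max_right _ _).trans (le_max_right _ _)) hLℓ
    have hℓD : ¬ (ℓ : ℤ) ∣ D := fun hdvd ↦ by
      have h1 : ℓ ∣ D.natAbs := Int.natCast_dvd.mp hdvd
      exact absurd (Nat.le_of_dvd (Int.natAbs_pos.mpr (by omega)) h1) (not_le.mpr hℓD')
    have hΔ : ¬ (ℓ : ℤ) ∣ minimalDiscriminantInt (C • WeierstrassCurve.ofJ j₀) := fun hdvd ↦ by
      have h1 : ℓ ∣ (minimalDiscriminantInt (C • WeierstrassCurve.ofJ j₀)).natAbs :=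
        Int.natCast_dvd.mp hdvd
      exact absurd (Nat.le_of_dvd (Int.natAbs_pos.mpr
        (minimalDiscriminantInt_ne_zero (C • WeierstrassCurve.ofJ j₀))) h1) (not_le.mpr hℓΔ')
    exact exists_sqrt_twist_cartan_of_j_eq (C • WeierstrassCurve.ofJ j₀) hψR hD hψψ hχ hrel ℓ
      hℓ3 hℓD hΔ W (hWj.trans hRj.symm)
  choose! L hL using key
  refine ⟨cmJInvariants.sup L, fun W _ hCM ℓ hℓ hlt ↦ ?_⟩
  have hjW : W.j ∈ cmJInvariants := (hasCM_iff_j_mem_holds W).mp hCM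
  exact hL W.j hjW W rfl ℓ hℓ (lt_of_le_of_lt (Finset.le_sup hjW) hlt)

end Literature.NumberTheory.EllipticCurves

end
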